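import Mathlib
import HarnessLib
import Summits.ValiantsHypothesis.ValiantsHypothesis.Theorems.LacunarySymmetroidMatrixDescartesOsculationLawTwoKCusp

/-!
# ValiantsHypothesis / LacunarySymmetroid — crux `MatrixDescartes` (stmt-ValiantsHypothesis-18050, V1),
# line «osculation-law»: the MONIC CUBIC cusp curve — counting tools

File 2/4 of the `(r,s) = (3,0)` piece of the `m = 3` rung (`…OsculationLawCuspCubic` has the algebra).  Tools for
the count of a finite osculation set of `Φ = b³ + σ₁b² + σ₂b + σ₃`, all elementary (no definitions, no named facts):

* `fibre_three_le` — a set of points `(t, b)` with `t > 0` a root of a fixed nonzero `P ∈ ℝ[X]` and `b` a root of the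
  monic cubic `Φ(t, ·)` has at most `3·|supp P|` elements (≤ 3 ordinates per abscissa; Descartes' rule with
  multiplicity, `OsculationRankOne.card_roots_filter_pos_le_card_support`, bounds the abscissae);
* `inj_le` — a set on which the ordinate is a function of the abscissa, all abscissae positive roots of a nonzero
  `P`, has at most `|supp P|` elements;
* `disc_nonneg_of_factor` — if the monic cubic is real-rooted and `R₂²·Φ(t,·) = (R₂ b + c)·(R₂b² + R₁b + R₀)`
  identically in `b` with `R₂ ≠ 0`, then `R₁² − 4R₂R₀ ≥ 0` (a quadratic factor of a real-rooted cubic is real-rooted;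
  three evaluations, no unique factorisation needed);
* `root_formula` — the two roots of `R₂b² + R₁b + R₀` (`R₂ ≠ 0`, nonnegative discriminant) are
  `(−R₁ ± √disc)/(2R₂)` (Mathlib `quadratic_eq_zero_iff`).

Honest framing: helper lemmas for a located rung of an UNREGISTERED V1 law line; `OsculationLaw`, `PeelInequality`,
`MatrixDescartes`, Conjecture B and `VP ≠ VNP` are OPEN / NOT proved.
-/

-- `Summit.ValiantsHypothesis.ValiantsHypothesis.…` is the tree's mandated single-conjunct layout (Sub = Summit).
set_option linter.dupNamespace false

noncomputable section

namespace Summit.ValiantsHypothesis.ValiantsHypothesis.Theorems.LacunarySymmetroidMatrixDescartes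

open Polynomial Set
open scoped BigOperators

namespace OsculationCuspCubic

/-! ### Fibres over the roots of a nonzero polynomial -/

/-- **Three ordinates per abscissa.**  If every point `p` of `T` has `p 0 > 0` a root of the nonzero polynomial `P`
and `p 1` a root of the monic cubic `b³ + σ₁(p 0)b² + σ₂(p 0)b + σ₃(p 0)`, then `#T ≤ 3·|supp P|`. [folklore] -/
theorem fibre_three_le (σ₁ σ₂ σ₃ P : ℝ[X]) (hP : P ≠ 0) (T : Set (Fin 2 → ℝ))
    (hT : ∀ p ∈ T, 0 < p 0 ∧ P.IsRoot (p 0) ∧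
      p 1 ^ 3 + p 1 ^ 2 * σ₁.eval (p 0) + p 1 * σ₂.eval (p 0) + σ₃.eval (p 0) = 0) :
    T.ncard ≤ 3 * P.support.card := by
  classical
  set TP : Finset ℝ := P.roots.toFinset.filter (fun t => 0 < t) with hTP
  set cub : ℝ → ℝ[X] := fun t => C 1 * X ^ 3 + C (σ₁.eval t) * X ^ 2 + C (σ₂.eval t) * X + C (σ₃.eval t)
    with hcub
  have hcub_deg : ∀ t, (cub t).natDegree = 3 := fun t => by
    rw [hcub]; exact Polynomial.natDegree_cubic one_ne_zero
  have hcub_ne : ∀ t, cub t ≠ 0 := by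
    intro t h0
    have := hcub_deg t
    rw [h0, natDegree_zero] at this
    exact absurd this (by norm_num)
  set S : Finset (Fin 2 → ℝ) :=
    TP.biUnion (fun t => ((cub t).roots.toFinset).image (fun b => (![t, b] : Fin 2 → ℝ))) with hS
  have hsub : T ⊆ (S : Set (Fin 2 → ℝ)) := by
    intro p hp
    obtain ⟨htp, hroot, hΦp⟩ := hT p hp
    rw [Finset.mem_coe, hS, Finset.mem_biUnion]
    refine ⟨p 0, ?_, ?_⟩
    · rw [hTP, Finset.mem_filter, Multiset.mem_toFinset, mem_roots hP]
      exact ⟨hroot, htp⟩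
    · rw [Finset.mem_image]
      refine ⟨p 1, ?_, ?_⟩
      · rw [Multiset.mem_toFinset, mem_roots (hcub_ne _), hcub, IsRoot.def]
        simp only [eval_add, eval_mul, eval_C, eval_pow, eval_X, one_mul]
        linarith
      · funext i
        fin_cases i <;> rfl
  calc T.ncard ≤ (S : Set (Fin 2 → ℝ)).ncard := Set.ncard_le_ncard hsub (Finset.finite_toSet _)
    _ = S.card := Set.ncard_coe_finset _
    _ ≤ ∑ t ∈ TP, (((cub t).roots.toFinset).image (fun b => (![t, b] : Fin 2 → ℝ))).card :=
        Finset.card_biUnion_le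
    _ ≤ ∑ t ∈ TP, 3 := by
        refine Finset.sum_le_sum fun t _ => ?_
        calc _ ≤ ((cub t).roots.toFinset).card := Finset.card_image_le
          _ ≤ Multiset.card (cub t).roots := Multiset.toFinset_card_le _
          _ ≤ (cub t).natDegree := Polynomial.card_roots' _
          _ = 3 := hcub_deg t
    _ = 3 * TP.card := by rw [Finset.sum_const, smul_eq_mul, mul_comm]
    _ ≤ 3 * P.support.card := by
        apply Nat.mul_le_mul_left
        calc TP.card = (P.roots.filter (fun t => 0 < t)).toFinset.card := by
              rw [hTP, Multiset.toFinset_filter]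
          _ ≤ Multiset.card (P.roots.filter (fun t => 0 < t)) := Multiset.toFinset_card_le _
          _ ≤ P.support.card := OsculationRankOne.card_roots_filter_pos_le_card_support P

/-- **One ordinate per abscissa.**  If on `T` the ordinate is determined by the abscissa and every abscissa is a
positive root of the nonzero polynomial `P`, then `#T ≤ |supp P|`. [folklore] -/
theorem inj_le (P : ℝ[X]) (hP : P ≠ 0) (T : Set (Fin 2 → ℝ))
    (hT : ∀ p ∈ T, 0 < p 0 ∧ P.IsRoot (p 0)) (hinj : ∀ p ∈ T, ∀ q ∈ T, p 0 = q 0 → p 1 = q 1) :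
    T.ncard ≤ P.support.card := by
  classical
  have hmaps : ∀ p ∈ T, (fun p : Fin 2 → ℝ => p 0) p ∈
      ((P.roots.toFinset.filter (fun t => 0 < t) : Finset ℝ) : Set ℝ) := by
    intro p hp
    obtain ⟨htp, hroot⟩ := hT p hp
    simp only [Finset.coe_filter, Set.mem_setOf_eq, Multiset.mem_toFinset]
    exact ⟨(mem_roots hP).2 hroot, htp⟩
  have hinj' : Set.InjOn (fun p : Fin 2 → ℝ => p 0) T := by
    intro p hp q hq hpq
    have hb : p 1 = q 1 := hinj p hp q hq hpq
    funext i
    fin_cases i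
    · exact hpq
    · exact hb
  calc T.ncard ≤ ((P.roots.toFinset.filter (fun t => 0 < t) : Finset ℝ) : Set ℝ).ncard :=
        Set.ncard_le_ncard_of_injOn _ hmaps hinj' (Finset.finite_toSet _)
    _ = (P.roots.toFinset.filter (fun t => 0 < t)).card := Set.ncard_coe_finset _
    _ = (P.roots.filter (fun t => 0 < t)).toFinset.card := by rw [Multiset.toFinset_filter]
    _ ≤ Multiset.card (P.roots.filter (fun t => 0 < t)) := Multiset.toFinset_card_le _
    _ ≤ P.support.card := OsculationRankOne.card_roots_filter_pos_le_card_support P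

/-! ### A quadratic factor of a real-rooted cubic is real-rooted -/

/-- If `b³ + s₁b² + s₂b + s₃ = (b − μ₁)(b − μ₂)(b − μ₃)` for all `b` and `r₂²·(b³ + s₁b² + s₂b + s₃) =
(r₂ b + c)·(r₂b² + r₁b + r₀)` for all `b` with `r₂ ≠ 0`, then `r₁² − 4 r₂ r₀ ≥ 0`.  (Evaluate at the `μᵢ`: either
some `μᵢ` is a root of the quadratic, or all three equal `μ` and the evaluations at `μ ± 1` force `μ` to be a root.)
[folklore] -/
theorem disc_nonneg_of_factor {s₁ s₂ s₃ r₂ r₁ r₀ c : ℝ} (hr₂ : r₂ ≠ 0)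
    (hreal : ∃ μ₁ μ₂ μ₃ : ℝ, ∀ b : ℝ, b ^ 3 + b ^ 2 * s₁ + b * s₂ + s₃ = (b - μ₁) * (b - μ₂) * (b - μ₃))
    (hid : ∀ b : ℝ, r₂ ^ 2 * (b ^ 3 + b ^ 2 * s₁ + b * s₂ + s₃) = (r₂ * b + c) * (r₂ * b ^ 2 + r₁ * b + r₀)) :
    0 ≤ r₁ ^ 2 - 4 * r₂ * r₀ := by
  obtain ⟨μ₁, μ₂, μ₃, hμ⟩ := hreal
  -- a root of the quadratic makes the discriminant a square
  have key : ∀ μ : ℝ, r₂ * μ ^ 2 + r₁ * μ + r₀ = 0 → 0 ≤ r₁ ^ 2 - 4 * r₂ * r₀ := by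
    intro μ hq
    have : r₁ ^ 2 - 4 * r₂ * r₀ = (2 * r₂ * μ + r₁) ^ 2 := by linear_combination (-4) * r₂ * hq
    rw [this]; exact sq_nonneg _
  have hev : ∀ μ : ℝ, (μ - μ₁) * (μ - μ₂) * (μ - μ₃) = 0 → (r₂ * μ + c) * (r₂ * μ ^ 2 + r₁ * μ + r₀) = 0 := by
    intro μ h0
    rw [← hid μ, hμ μ, h0, mul_zero]
  have h1 := hev μ₁ (by ring)
  have h2 := hev μ₂ (by ring)
  have h3 := hev μ₃ (by ring)
  rcases mul_eq_zero.1 h1 with h1a | h1b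
  · rcases mul_eq_zero.1 h2 with h2a | h2b
    · rcases mul_eq_zero.1 h3 with h3a | h3b
      · -- all three roots equal `μ := μ₁`
        have e2 : μ₂ = μ₁ := by
          have : r₂ * (μ₂ - μ₁) = 0 := by linarith
          rcases mul_eq_zero.1 this with h | h
          · exact absurd h hr₂
          · linarith
        have e3 : μ₃ = μ₁ := by
          have : r₂ * (μ₃ - μ₁) = 0 := by linarith
          rcases mul_eq_zero.1 this with h | h
          · exact absurd h hr₂
          · linarith
        have hc : c = -(r₂ * μ₁) := by linarith
        -- evaluate the identity at `μ₁ + 1` and `μ₁ - 1`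
        have hp := hid (μ₁ + 1)
        have hm := hid (μ₁ - 1)
        rw [hμ, e2, e3, hc] at hp hm
        have hp' : r₂ * (r₂ * (μ₁ + 1) ^ 2 + r₁ * (μ₁ + 1) + r₀) = r₂ * r₂ := by nlinarith [hp]
        have hm' : r₂ * (r₂ * (μ₁ - 1) ^ 2 + r₁ * (μ₁ - 1) + r₀) = r₂ * r₂ := by nlinarith [hm]
        have hp'' : r₂ * (μ₁ + 1) ^ 2 + r₁ * (μ₁ + 1) + r₀ = r₂ := mul_left_cancel₀ hr₂ hp'
        have hm'' : r₂ * (μ₁ - 1) ^ 2 + r₁ * (μ₁ - 1) + r₀ = r₂ := mul_left_cancel₀ hr₂ hm'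
        exact key μ₁ (by nlinarith [hp'', hm''])
      · exact key μ₃ h3b
    · exact key μ₂ h2b
  · exact key μ₁ h1b

/-- **The two roots of `r₂b² + r₁b + r₀`** (`r₂ ≠ 0`, nonnegative discriminant): `b = (−r₁ ± √disc)/(2r₂)`.
[folklore] -/
theorem root_formula {r₂ r₁ r₀ b : ℝ} (hr₂ : r₂ ≠ 0) (hD : 0 ≤ r₁ ^ 2 - 4 * r₂ * r₀)
    (hq : r₂ * b ^ 2 + r₁ * b + r₀ = 0) :
    b = (-r₁ + Real.sqrt (r₁ ^ 2 - 4 * r₂ * r₀)) / (2 * r₂) ∨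
      b = (-r₁ - Real.sqrt (r₁ ^ 2 - 4 * r₂ * r₀)) / (2 * r₂) := by
  have hs : discrim r₂ r₁ r₀ = Real.sqrt (r₁ ^ 2 - 4 * r₂ * r₀) * Real.sqrt (r₁ ^ 2 - 4 * r₂ * r₀) := by
    rw [discrim, Real.mul_self_sqrt hD]
  have hq' : r₂ * (b * b) + r₁ * b + r₀ = 0 := by rw [← sq]; exact hq
  exact (quadratic_eq_zero_iff hr₂ hs b).1 hq'

/-- Conversely both values are roots. [folklore] -/
theorem root_of_formula {r₂ r₁ r₀ ε : ℝ} (hr₂ : r₂ ≠ 0) (hD : 0 ≤ r₁ ^ 2 - 4 * r₂ * r₀)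
    (hε : ε = 1 ∨ ε = -1) :
    r₂ * ((-r₁ + ε * Real.sqrt (r₁ ^ 2 - 4 * r₂ * r₀)) / (2 * r₂)) ^ 2
      + r₁ * ((-r₁ + ε * Real.sqrt (r₁ ^ 2 - 4 * r₂ * r₀)) / (2 * r₂)) + r₀ = 0 := by
  have hs : discrim r₂ r₁ r₀ = Real.sqrt (r₁ ^ 2 - 4 * r₂ * r₀) * Real.sqrt (r₁ ^ 2 - 4 * r₂ * r₀) := by
    rw [discrim, Real.mul_self_sqrt hD]
  set x := (-r₁ + ε * Real.sqrt (r₁ ^ 2 - 4 * r₂ * r₀)) / (2 * r₂) with hx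
  have h := (quadratic_eq_zero_iff hr₂ hs x).2
  rw [sq]
  apply h
  rcases hε with rfl | rfl
  · left; rw [hx]; ring
  · right; rw [hx]; ring

end OsculationCuspCubic

end Summit.ValiantsHypothesis.ValiantsHypothesis.Theorems.LacunarySymmetroidMatrixDescartes
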